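import Literature.Barriers.CriticalPhenomena.IsingTrivialityFromDimensionFourProofs
import Literature.Probability.LatticeModels.AizenmanWickBound
import HarnessLib

/-!
# Barrier `IsingTrivialityFromDimensionFour`: assembly from the source form of Aizenman's inequality

Second sibling proof file of `Literature.Barriers.CriticalPhenomena.IsingTrivialityFromDimensionFour`
(theorems only; no statement of that file or of `IsingTrivialityFromDimensionFourProofs` is
changed). The random-current input of Aizenman–Duminil-Copin's Proposition 1.4 is here taken in
the form **printed by its source**, Aizenman 1982, Prop. 12.1 (Comm. Math. Phys. 86, eq. (12.3);
Aizenman CDM 2020, Prop. 7.2 (7.1); Panis 2023, Prop. 4.6):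
`|S_{2n} - G_{2n}| ≤ (3/2) ∑_{i<j<k<l} |U₄(x_i,x_j,x_k,x_l)| G_{2n-4}(remaining points)` with the
**Wick functional** `G_{2n-4}` of the remaining points — the named fact
`Literature.Probability.LatticeModels.aizenman_wickDeviation_le_finite` of `AizenmanWickBound` —
instead of the quotation of Aizenman–Duminil-Copin 2021, §6.3, first display (the
`(2n-4)`-point function `S_{2n-4}` in place of `G_{2n-4}`, a stronger statement than the source
theorem; the tree's `aizenman_pairingSum_sub_nPoint_le_finite`), on which
`IsingTrivialityFromDimensionFour.of_finiteVolumeFacts` / `of_fourFacts` and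
`criticalSmearedMGF_bound_four_nonneg.of_facts` of `IsingTrivialityFromDimensionFourProofs` rest.

## Contents

* `abs_criticalSmearedMGF_sub_one_le_of_wickBounds` — one state at `β_c` with the plus
  correlations satisfying Newman's Gaussian domination (`PairingLowerBound`) and Aizenman's
  Prop. 12.1 (`WickDeviationBound`):
  `|⟨exp[z T_{f,L} - (z²/2)⟨T_{f,L}²⟩]⟩_{β_c} - 1| ≤ e^{-z²⟨T_{f,L}²⟩/2} e^{z²⟨T_{|f|,L}²⟩/2} · 24 ‖f‖_∞⁴ S(μ;L,r) z⁴`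
  (Aizenman–Duminil-Copin 2021, §6.3, third display; Aizenman CDM 2020, (7.9)); for `f ≥ 0`
  the two exponentials cancel (`…_of_nonneg`).
* `tendsto_criticalSmearedMGF_one_of_wickBounds` — `→ 1` whenever `S(μ; L, r) → 0`
  (Aizenman CDM 2020, Cor. 7.3).
* `criticalSmearedMGF_bound_four_nonneg.of_wickDeviation_criticalBeta` /
  `.of_wickDeviation` — **the derived shape `criticalSmearedMGF_bound_four_nonneg` (ADC
  Prop. 1.4 as proved: `f ≥ 0`, box radius `r ≥ 1`) from exactly two named facts**: Aizenman
  1982, Prop. 12.1 in finite volume (`aizenman_wickDeviation_le_finite`) and the `d = 4` bound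
  on `∑ |U₄|` at `β_c` (the `β = β_c` case of `aizenmanDuminilCopin_ursellFourSum_le`, ADC
  Thm 1.3 with §6.3); everything else — the free DLR state (`exists_freeMeasure_holds`),
  `m*(β_c) = 0` (`spontaneousMagnetization_criticalBeta_eq_zero_holds`,
  Aizenman–Duminil-Copin–Sidoravicius 2015), Newman's lower half
  (`aizenman_nPoint_le_pairingSum_finite_holds`), the flip symmetry, the thermodynamic limit,
  the smearing and the summation — being theorems of the tree.
* `IsingTrivialityFromDimensionFour.of_wickDeviation_tendsto` / `.of_wickDeviation` — the
  barrier from Aizenman's Prop. 12.1 and the smallness `Σ_L⁻² ∑ |U₄| → 0` at `β_c` (`d ≥ 4`),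
  resp. from three named facts: `aizenman_wickDeviation_le_finite`,
  `aizenmanDuminilCopin_ursellFourSum_le` (`d = 4`), `panis_ursellFourSum_le` (`d ≥ 5`).

## References

* M. Aizenman, Comm. Math. Phys. 86 (1982) 1–48, Prop. 12.1, eq. (12.3) [AizenmanCMP1982].
* M. Aizenman, CDM 2020 (arXiv:2112.04248), §7: Prop. 7.2 (7.1), (7.6)–(7.11), Cor. 7.3
  [AizenmanCDM2020].
* M. Aizenman, H. Duminil-Copin, Ann. of Math. 194 (2021) (arXiv:1912.07973), Prop. 1.4, Thm 1.3,
  §6.3 (p. 26) [AizenmanDuminilCopinAnnals2021].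
* R. Panis, arXiv:2309.05797, Prop. 4.6, Thm 5.5 [Panis2023Triviality].
-/

noncomputable section

open MeasureTheory Filter Topology Finset
open Literature.Probability.LatticeModels Literature.Probability.Percolation

namespace Literature.Barriers.CriticalPhenomena

variable {d : ℕ}

/-! ### 1. One state: the deviation of the critical moment generating function from `1` -/

/-- **The deviation of the critical moment generating function from `1`, one state satisfying
Newman's Gaussian domination and Aizenman's Prop. 12.1.** Let `μ` be a DLR state at `(β_c, 0)`
whose correlations are the plus correlations and whose odd correlations vanish, satisfying
`PairingLowerBound μ` and `WickDeviationBound μ`. For `f ∈ C_0` vanishing outside `[-r, r]^d`,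
`L ≥ 1` and real `z`:
`|⟨exp[z T_{f,L} - (z²/2)⟨T_{f,L}²⟩]⟩_{β_c} - 1|
  ≤ exp(-z²⟨T_{f,L}²⟩/2) exp(z²⟨T_{|f|,L}²⟩/2) · 24 ‖f‖_∞⁴ S(μ;L,r) z⁴`
(Aizenman–Duminil-Copin 2021, §6.3, p. 26, third display, divided by `exp(z²⟨T_{f,L}²⟩/2)`;
Aizenman CDM 2020, (7.9); the random-current input in the source form,
`abs_mgf_normalizedField_sub_exp_le_of_wickBounds` of `AizenmanWickBound`). [cite: AizenmanDuminilCopinAnnals2021, §6.3 (p. 26, third display)] [cite: AizenmanCDM2020, §7 eq. (7.9)] [cite: AizenmanCMP1982, Prop. 12.1] -/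
theorem abs_criticalSmearedMGF_sub_one_le_of_wickBounds
    {μ : Measure (SpinConfig (Site d))} (hμG : μ ∈ isingGibbsMeasures d (criticalBeta d) 0)
    (hμ : ∀ A : Finset (Site d), spinCorr μ A = plusCorr d (criticalBeta d) 0 A)
    (hlow : PairingLowerBound μ) (hW : WickDeviationBound μ)
    (hodd : ∀ {n : ℕ}, Odd n → ∀ x : Fin n → Site d, ∫ σ, ∏ i, spinAt (x i) σ ∂μ = 0)
    {f : EuclideanSpace ℝ (Fin d) → ℝ} (hf : Continuous f) {r : ℝ}
    (hfr : ∀ x, f x ≠ 0 → ∀ i, |x i| ≤ r) {L : ℕ} (hL : 1 ≤ L) (z : ℝ) :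
    |criticalSmearedMGF d f L z - 1| ≤
      Real.exp (-(z ^ 2 / 2 * ∫ σ, normalizedField μ L f σ ^ 2 ∂μ)) *
        Real.exp (z ^ 2 / 2 * ∫ σ, normalizedField μ L (fun x => |f x|) σ ^ 2 ∂μ) *
          (24 * (⨆ x, |f x|) ^ 4 * ursellFourSum μ L r * z ^ 4) := by
  haveI : IsProbabilityMeasure μ := hμG.1
  have hLpos : (0 : ℝ) < (L : ℝ) := Nat.cast_pos.mpr (by omega)
  have key := abs_mgf_normalizedField_sub_exp_le_of_wickBounds hlow hW hodd hLpos hf hfr z (r := r)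
  set V : ℝ := ∫ σ, normalizedField μ L f σ ^ 2 ∂μ with hV
  rw [criticalSmearedMGF_eq hμ hfr hL z, ← hV]
  have hpos : 0 < Real.exp (z ^ 2 / 2 * V) := Real.exp_pos _
  have h1 : Real.exp (-(z ^ 2 / 2 * V)) * (∫ σ, Real.exp (z * normalizedField μ L f σ) ∂μ) - 1 =
      Real.exp (-(z ^ 2 / 2 * V)) *
        ((∫ σ, Real.exp (z * normalizedField μ L f σ) ∂μ) - Real.exp (z ^ 2 / 2 * V)) := by
    rw [mul_sub, Real.exp_neg, inv_mul_cancel₀ hpos.ne']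
  rw [h1, abs_mul, Real.abs_exp, mul_assoc]
  exact mul_le_mul_of_nonneg_left key (Real.exp_pos _).le

/-- **The same for non-negative test functions**: for `f ≥ 0` the two exponential factors cancel
(`T_{|f|,L} = T_{f,L}`), giving the printed normalised form
`|⟨exp[z T_{f,L} - (z²/2)⟨T_{f,L}²⟩]⟩_{β_c} - 1| ≤ 24 ‖f‖_∞⁴ S(μ;L,r) z⁴`
(Aizenman–Duminil-Copin 2021, Prop. 1.4, as used on p. 6 for `f ≥ 0`; Aizenman CDM 2020,
(7.8)). [cite: AizenmanDuminilCopinAnnals2021, Prop. 1.4 (p. 6)] [cite: AizenmanCDM2020, §7 eq. (7.8)] -/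
theorem abs_criticalSmearedMGF_sub_one_le_of_wickBounds_of_nonneg
    {μ : Measure (SpinConfig (Site d))} (hμG : μ ∈ isingGibbsMeasures d (criticalBeta d) 0)
    (hμ : ∀ A : Finset (Site d), spinCorr μ A = plusCorr d (criticalBeta d) 0 A)
    (hlow : PairingLowerBound μ) (hW : WickDeviationBound μ)
    (hodd : ∀ {n : ℕ}, Odd n → ∀ x : Fin n → Site d, ∫ σ, ∏ i, spinAt (x i) σ ∂μ = 0)
    {f : EuclideanSpace ℝ (Fin d) → ℝ} (hf : Continuous f) (hf0 : ∀ x, 0 ≤ f x) {r : ℝ}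
    (hfr : ∀ x, f x ≠ 0 → ∀ i, |x i| ≤ r) {L : ℕ} (hL : 1 ≤ L) (z : ℝ) :
    |criticalSmearedMGF d f L z - 1| ≤ 24 * (⨆ x, |f x|) ^ 4 * ursellFourSum μ L r * z ^ 4 := by
  have key := abs_criticalSmearedMGF_sub_one_le_of_wickBounds hμG hμ hlow hW hodd hf hfr hL z
  have habs : (fun x => |f x|) = f := funext fun x => abs_of_nonneg (hf0 x)
  have hint : (∫ σ, normalizedField μ L (fun x => |f x|) σ ^ 2 ∂μ) =
      ∫ σ, normalizedField μ L f σ ^ 2 ∂μ := by rw [habs]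
  rw [hint, ← Real.exp_add, neg_add_cancel, Real.exp_zero, one_mul] at key
  exact key

/-- **`⟨exp[z T_{f,L} - (z²/2)⟨T_{f,L}²⟩]⟩_{β_c} → 1` whenever `S(μ; L, r) → 0`**, for a
translation-invariant DLR state `μ` at `(β_c, 0)` with the plus correlations and vanishing odd
correlations which satisfies Newman's Gaussian domination and Aizenman's Prop. 12.1 (Aizenman,
CDM 2020, Cor. 7.3, at the level of the moment generating functions of the plus state at `β_c`;
the variance `⟨T_{|f|,L}²⟩` is bounded uniformly in `L` by translation invariance and Griffiths'
first inequality, `integral_normalizedField_sq_le`). [cite: AizenmanCDM2020, §7 Cor. 7.3 with (7.9)–(7.11)] -/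
theorem tendsto_criticalSmearedMGF_one_of_wickBounds
    {μ : Measure (SpinConfig (Site d))} (hμG : μ ∈ isingGibbsMeasures d (criticalBeta d) 0)
    (hTI : IsTranslationInvariantMeasure μ)
    (hμ : ∀ A : Finset (Site d), spinCorr μ A = plusCorr d (criticalBeta d) 0 A)
    (hlow : PairingLowerBound μ) (hW : WickDeviationBound μ)
    (hodd : ∀ {n : ℕ}, Odd n → ∀ x : Fin n → Site d, ∫ σ, ∏ i, spinAt (x i) σ ∂μ = 0)
    (hS : ∀ r : ℝ, 1 ≤ r → Tendsto (fun L : ℕ => ursellFourSum μ L r) atTop (𝓝 0))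
    {f : EuclideanSpace ℝ (Fin d) → ℝ} (hf : Continuous f) (hfs : HasCompactSupport f) (z : ℝ) :
    Tendsto (fun L : ℕ => criticalSmearedMGF d f L z) atTop (𝓝 1) := by
  haveI : IsProbabilityMeasure μ := hμG.1
  have hβ := criticalBeta_nonneg d
  obtain ⟨r, hr1, hfr⟩ := exists_cube_of_hasCompactSupport f hfs
  have hfar : ∀ x, (fun y => |f y|) x ≠ 0 → ∀ i, |x i| ≤ r := fun x hx =>
    hfr x (abs_ne_zero.mp hx)
  -- Griffiths' first inequality in the plus state: non-negative pair correlations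
  have hG : ∀ x y, 0 ≤ ∫ σ, spinAt x σ * spinAt y σ ∂μ := by
    classical
    intro x y
    by_cases hxy : x = y
    · subst hxy
      simp
    · have hpair : ∀ σ, spinAt x σ * spinAt y σ = spinProduct {x, y} σ := fun σ => by
        rw [spinProduct, Finset.prod_pair hxy]
      simp_rw [hpair]
      change 0 ≤ spinCorr μ {x, y}
      rw [hμ]
      exact plusCorr_nonneg hβ le_rfl _
  set Cv : ℝ := (⨆ x, |(|f x|)|) ^ 2 * ((((2 * (⌈r⌉₊ + 1) + 1) ^ d : ℕ) : ℝ) ^ 2) with hCv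
  have hvar : ∀ L : ℕ, 1 ≤ L → ∫ σ, normalizedField μ L (fun x => |f x|) σ ^ 2 ∂μ ≤ Cv :=
    fun L hL => integral_normalizedField_sq_le μ hTI hG hf.abs hr1 hfar (Nat.one_le_cast.mpr hL)
  set K : ℝ := Real.exp (z ^ 2 / 2 * Cv) * (24 * (⨆ x, |f x|) ^ 4 * z ^ 4) with hK
  refine tendsto_one_of_abs_sub_le (L₀ := 1) (g := fun L : ℕ => K * ursellFourSum μ L r)
    (fun L hL => ?_) ?_
  · have hB : 0 ≤ 24 * (⨆ x, |f x|) ^ 4 * ursellFourSum μ L r * z ^ 4 :=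
      mul_nonneg (mul_nonneg (mul_nonneg (by norm_num) (pow_nonneg (iSup_abs_nonneg f) 4))
        (ursellFourSum_nonneg μ L r)) (by positivity)
    have hV0 : 0 ≤ ∫ σ, normalizedField μ L f σ ^ 2 ∂μ := integral_nonneg fun σ => sq_nonneg _
    have hexp1 : Real.exp (-(z ^ 2 / 2 * ∫ σ, normalizedField μ L f σ ^ 2 ∂μ)) ≤ 1 :=
      Real.exp_le_one_iff.mpr (neg_nonpos.mpr (mul_nonneg (by positivity) hV0))
    calc |criticalSmearedMGF d f L z - 1|
        ≤ Real.exp (-(z ^ 2 / 2 * ∫ σ, normalizedField μ L f σ ^ 2 ∂μ)) *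
            Real.exp (z ^ 2 / 2 * ∫ σ, normalizedField μ L (fun x => |f x|) σ ^ 2 ∂μ) *
              (24 * (⨆ x, |f x|) ^ 4 * ursellFourSum μ L r * z ^ 4) :=
          abs_criticalSmearedMGF_sub_one_le_of_wickBounds hμG hμ hlow hW hodd hf hfr hL z
      _ ≤ 1 * Real.exp (z ^ 2 / 2 * Cv) * (24 * (⨆ x, |f x|) ^ 4 * ursellFourSum μ L r * z ^ 4) :=
          mul_le_mul_of_nonneg_right
            (mul_le_mul hexp1
              (Real.exp_le_exp.mpr (mul_le_mul_of_nonneg_left (hvar L hL) (by positivity)))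
              (Real.exp_pos _).le zero_le_one) hB
      _ = K * ursellFourSum μ L r := by rw [hK]; ring
  · simpa using (hS r hr1).const_mul K

/-! ### 2. The derived shape `criticalSmearedMGF_bound_four_nonneg` from two named facts -/

/-- **Aizenman–Duminil-Copin 2021, Prop. 1.4, as its proof establishes it and p. 6 uses it
(`criticalSmearedMGF_bound_four_nonneg`), from Aizenman's Prop. 12.1 and the `d = 4` bound on
`∑ |U₄|` at `β_c` alone.** There exist `c, C > 0` such that at `β = β_c(4)`, for every `L ≥ 2`,
every `r ≥ 1`, every non-negative continuous `f` vanishing outside `[-r, r]⁴` and every real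
`z`, `|⟨exp[z T_{f,L} - (z²/2)⟨T_{f,L}²⟩]⟩_{β_c} - 1| ≤ C ‖f‖_∞⁴ r¹² z⁴ / (log L)^c`, granted only
(i) Aizenman 1982, Prop. 12.1 in finite volume (`aizenman_wickDeviation_le_finite`, the source
form with the Wick functional `G_{2n-4}`) and (ii) the bound
`Σ_L⁻² ∑_{Λ_{rL}⁴} |U₄| ≤ C r¹² (log L)^{-c}` for the DLR states **at `β_c(4)`** (`L > 1`,
`r ≥ 1`; the `β = β_c` case of `aizenmanDuminilCopin_ursellFourSum_le`, Aizenman–Duminil-Copin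
2021, Thm 1.3 with §6.3, the display "S(L,r,β) ≤ C₂ r¹² (log log L/log L)^c", p. 26), written out
as the hypothesis `hS₄`. The plus state at `β_c(4)` is the free DLR state
(`exists_freeMeasure_holds`; `m*(β_c) = 0`, `spontaneousMagnetization_criticalBeta_eq_zero_holds`,
via `freeCorr_eq_plusCorr_of_spontaneousMagnetization_eq_zero`), whose correlations are box
limits of free finite-volume correlations, so that Newman's lower half
(`aizenman_nPoint_le_pairingSum_finite_holds`) and (i) pass to it
(`pairingLowerBound_and_wickDeviationBound_of_freeCorr`) and its odd correlations vanish; the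
smearing and the summation over `n` are `abs_criticalSmearedMGF_sub_one_le_of_wickBounds_of_nonneg`
(constant `24 C`). [cite: AizenmanDuminilCopinAnnals2021, Proposition 1.4 (p. 6) with §6.3 (p. 26)] [cite: AizenmanCMP1982, Prop. 12.1] -/
theorem criticalSmearedMGF_bound_four_nonneg.of_wickDeviation_criticalBeta
    (hW : aizenman_wickDeviation_le_finite)
    (hS₄ : ∃ c C : ℝ, 0 < c ∧ 0 < C ∧ ∀ (L r : ℝ), 1 < L → 1 ≤ r →
      ∀ μ ∈ isingGibbsMeasures 4 (criticalBeta 4) 0,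
        ursellFourSum μ L r ≤ C * r ^ 12 / Real.log L ^ c) :
    criticalSmearedMGF_bound_four_nonneg := by
  obtain ⟨c, C, hc, hC, H⟩ := hS₄
  refine ⟨c, 24 * C, hc, by positivity, fun f hf hf0 r hr hfr L hL z => ?_⟩
  have hβ := criticalBeta_nonneg 4
  have hm' : spontaneousMagnetization 4 (criticalBeta 4) = 0 :=
    spontaneousMagnetization_criticalBeta_eq_zero_holds (d := 4) (by norm_num)
  obtain ⟨μ, hμG, -, hcorr⟩ := exists_freeMeasure_holds 4 (β := criticalBeta 4) 0 hβ le_rfl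
  haveI : IsProbabilityMeasure μ := hμG.1
  have hμ : ∀ A, spinCorr μ A = plusCorr 4 (criticalBeta 4) 0 A := fun A =>
    (hcorr A).trans (freeCorr_eq_plusCorr_of_spontaneousMagnetization_eq_zero hβ hm' A)
  obtain ⟨hlow, hWμ⟩ := pairingLowerBound_and_wickDeviationBound_of_freeCorr hW hβ hcorr
  have hodd : ∀ {n : ℕ}, Odd n → ∀ x : Fin n → Site 4, ∫ σ, ∏ i, spinAt (x i) σ ∂μ = 0 :=
    fun hn x => integral_prod_spinAt_eq_zero_of_freeCorr hβ hcorr hn x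
  have hL1 : 1 ≤ L := by omega
  have hLgt : (1 : ℝ) < (L : ℝ) := Nat.one_lt_cast.mpr (by omega)
  have hSle : ursellFourSum μ L r ≤ C * r ^ 12 / Real.log L ^ c := H L r hLgt hr μ hμG
  have key := abs_criticalSmearedMGF_sub_one_le_of_wickBounds_of_nonneg hμG hμ hlow hWμ hodd
    hf hf0 hfr hL1 z (r := r)
  refine key.trans ?_
  have h0 : 0 ≤ (⨆ x, |f x|) ^ 4 := pow_nonneg (iSup_abs_nonneg f) 4
  have hz : 0 ≤ z ^ 4 := by positivity
  calc 24 * (⨆ x, |f x|) ^ 4 * ursellFourSum μ L r * z ^ 4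
      ≤ 24 * (⨆ x, |f x|) ^ 4 * (C * r ^ 12 / Real.log L ^ c) * z ^ 4 := by gcongr
    _ = 24 * C * (⨆ x, |f x|) ^ 4 * r ^ 12 * z ^ 4 / Real.log L ^ c := by ring

/-- **`criticalSmearedMGF_bound_four_nonneg` from exactly two named facts of the tree**:
Aizenman 1982, Prop. 12.1 in finite volume (`aizenman_wickDeviation_le_finite`) and the `d = 4`
bound on `∑ |U₄|` in the critical window (`aizenmanDuminilCopin_ursellFourSum_le`, ADC Thm 1.3
with §6.3), used at `β = β_c` only. [cite: AizenmanDuminilCopinAnnals2021, Proposition 1.4 (p. 6) with §6.3 (p. 26)] [cite: AizenmanCMP1982, Prop. 12.1] -/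
theorem criticalSmearedMGF_bound_four_nonneg.of_wickDeviation
    (hW : aizenman_wickDeviation_le_finite) (hS₄ : aizenmanDuminilCopin_ursellFourSum_le) :
    criticalSmearedMGF_bound_four_nonneg := by
  refine criticalSmearedMGF_bound_four_nonneg.of_wickDeviation_criticalBeta hW ?_
  obtain ⟨c, C, hc, hC, H⟩ := hS₄
  exact ⟨c, C, hc, hC, fun L r hL hr μ hμ =>
    H (criticalBeta 4) L r (criticalBeta_nonneg 4) le_rfl (Or.inl rfl) hL hr μ hμ⟩

/-! ### 3. The barrier -/

/-- **The barrier from Aizenman's Prop. 12.1 and the smallness of `Σ_L⁻² ∑ |U₄|` at `β_c`.**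
For every `d ≥ 4` the critical nearest-neighbour Ising model on `ℤ^d` has no non-Gaussian
smeared scaling limit, granted Aizenman 1982, Prop. 12.1 in finite volume
(`aizenman_wickDeviation_le_finite`) and, for each `d ≥ 4`, the convergence
`Σ_L⁻² ∑_{x ∈ Λ_{rL}⁴} |U₄^μ(x)| → 0` (`L → ∞`, every `r ≥ 1`) for the DLR states `μ` at
`(β_c(d), 0)` — the conclusion of the tree diagram bounds (improved for `d = 4`,
Aizenman–Duminil-Copin 2021, Thm 1.3/§6.3; plain for `d ≥ 5`, Aizenman 1982 / Panis 2023 §5),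
written out as the hypothesis `hS` (Aizenman, CDM 2020, Cor. 7.3: Gaussianity "in any sequential
limit in which … `R_{rL}(β) → 0` for each `r < ∞`"). The free DLR state and `m*(β_c) = 0` are
theorems of the tree. [cite: AizenmanCDM2020, §7 Cor. 7.3] [cite: AizenmanCMP1982, Prop. 12.1] -/
theorem IsingTrivialityFromDimensionFour.of_wickDeviation_tendsto
    (hW : aizenman_wickDeviation_le_finite)
    (hS : ∀ d : ℕ, 4 ≤ d → ∀ μ ∈ isingGibbsMeasures d (criticalBeta d) 0,
      ∀ r : ℝ, 1 ≤ r → Tendsto (fun L : ℕ => ursellFourSum μ L r) atTop (𝓝 0)) :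
    IsingTrivialityFromDimensionFour := by
  intro d hd
  rintro ⟨f, hf, hfs, z, -, hnot⟩
  refine hnot ?_
  have hβ := criticalBeta_nonneg d
  have hm' : spontaneousMagnetization d (criticalBeta d) = 0 :=
    spontaneousMagnetization_criticalBeta_eq_zero_holds (d := d) (by omega)
  obtain ⟨μ, hμG, hTI, hcorr⟩ := exists_freeMeasure_holds d (β := criticalBeta d) 0 hβ le_rfl
  have hμ : ∀ A, spinCorr μ A = plusCorr d (criticalBeta d) 0 A := fun A =>
    (hcorr A).trans (freeCorr_eq_plusCorr_of_spontaneousMagnetization_eq_zero hβ hm' A)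
  have hodd : ∀ {n : ℕ}, Odd n → ∀ x : Fin n → Site d, ∫ σ, ∏ i, spinAt (x i) σ ∂μ = 0 :=
    fun hn x => integral_prod_spinAt_eq_zero_of_freeCorr hβ hcorr hn x
  obtain ⟨hlow, hWμ⟩ := pairingLowerBound_and_wickDeviationBound_of_freeCorr hW hβ hcorr
  exact tendsto_criticalSmearedMGF_one_of_wickBounds hμG hTI hμ hlow hWμ hodd (hS d hd μ hμG) hf hfs z

/-- **The barrier from three named facts of the tree.** For every `d ≥ 4` the critical
nearest-neighbour Ising model on `ℤ^d` has no non-Gaussian smeared scaling limit, granted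
Aizenman 1982, Prop. 12.1 in finite volume (`aizenman_wickDeviation_le_finite`) and the two
bounds on `∑ |U₄|` (`aizenmanDuminilCopin_ursellFourSum_le`, `d = 4`, Aizenman–Duminil-Copin
2021, Thm 1.3/§6.3; `panis_ursellFourSum_le`, `d ≥ 5`, tree diagram bound and infrared bounds,
Panis 2023, §5), both used at `β_c` only (`tendsto_ursellFourSum_zero_four`,
`tendsto_ursellFourSum_zero_highDim` of `IsingTrivialityFromDimensionFourProofs`). The free DLR
state and the continuity of the magnetisation at `β_c` (Aizenman–Duminil-Copin–Sidoravicius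
2015), hypotheses of `IsingTrivialityFromDimensionFour.of_finiteVolumeFacts`, are theorems of the
tree (`exists_freeMeasure_holds`, `spontaneousMagnetization_criticalBeta_eq_zero_holds`).
[cite: AizenmanCMP1982, Prop. 12.1] [cite: AizenmanDuminilCopinAnnals2021, Prop. 1.4, Thm 1.3 and §6.3 (p. 26)] [cite: Panis2023Triviality, Thm. 5.5] [cite: AizenmanCDM2020, §7 Cor. 7.3] -/
theorem IsingTrivialityFromDimensionFour.of_wickDeviation
    (hW : aizenman_wickDeviation_le_finite)
    (hS₄ : aizenmanDuminilCopin_ursellFourSum_le) (hS₅ : panis_ursellFourSum_le) :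
    IsingTrivialityFromDimensionFour := by
  refine IsingTrivialityFromDimensionFour.of_wickDeviation_tendsto hW fun d hd μ hμG r hr => ?_
  rcases hd.eq_or_lt with h4 | hlt
  · subst h4
    exact tendsto_ursellFourSum_zero_four hS₄ hμG hr
  · exact tendsto_ursellFourSum_zero_highDim hS₅ hlt hμG hr

/-- Consequently no dimension-uniform derivation of non-triviality, granted the same three
facts (`IsingTrivialityFromDimensionFour.not_dimensionUniform`). [cite: AizenmanCDM2020, §11 (1)] -/
theorem not_dimensionUniform_hasNonGaussianCriticalSmearing_of_wickDeviation
    (hW : aizenman_wickDeviation_le_finite)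
    (hS₄ : aizenmanDuminilCopin_ursellFourSum_le) (hS₅ : panis_ursellFourSum_le) :
    ¬ DimensionUniform HasNonGaussianCriticalSmearing :=
  (IsingTrivialityFromDimensionFour.of_wickDeviation hW hS₄ hS₅).not_dimensionUniform

end Literature.Barriers.CriticalPhenomena
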